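import Summits.QuantumFields.BalabanUV.Beta.EriceRemainderEnclosureHistoryAutonomyEnd
import Summits.QuantumFields.BalabanUV.Beta.EriceRemainderEnclosureHistoryAutonomyThresholdWellPosed

/-!
# EriceRemainderEnclosureHistoryAutonomyEndSharp — (E38d) THE AUTONOMY ROW'S ENDs AT THE SHARP CONSTANT: (E37c)'s intrinsic characterisation
# of the continuum running coupling under node U2's `InjectedRate` + rows `Σ_i Λ k i ≤ M` of the history modulus, RE-POINTED from `M·γ < b`
# to the CLOSED `M·γ ≤ 3√3·b` for «`gstar g` is THE box solution ∕ depends on β only through `betaInf β`» ((E38a) `memFlow_unique_zs_closed`)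
# and to the open `M·γ < 3√3·b` with the sharp Lipschitz constant for stability across families and the lattice-free Picard limit ((E38b))

Cell `pub-balaban`, β-function sub-cell, BINDER row D4 «RemainderConst leaves for Bałaban's split» (`HOME/BINDER-OWNERS.md`; owner
lineage `b2b-balaban-beta-an4`; this file by co-owner #2 lineage `b2b-balaban-beta-d4-p2`, generation 40), β-FLOW TEAM duty (1),
FREEZE (0) honoured (def-free; (E37c)'s `zerothMoment_betaInf_of_rows` ∕ `rowBound_nonneg`, (E37a)'s `_of_tendsto` ∕ `_of_injectedRate`
family, (E38a)∕(E38b) BY NAME — the binder lists are (E37c)'s VERBATIM but for `hsmall`).  Imports (E37c) + (E38b).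

HONEST FRAMING (page 1, verbatim and binding).  *"Discharging BetaPertH makes Bałaban's UV stability UNCONDITIONAL — a real
constructive-QFT result; it is NOT the continuum limit and NOT the Clay problem."*  THIS FILE DISCHARGES NOTHING OF THE KIND.  The
hypotheses are node U2's ∕ NE4's NOT-IN-PRINT shapes (`InjectedRate`, `ScaleShiftRate`, `HistLipschitz` + row budget, `EventualLowerH`;
GAPS G-t4-U2-1∕-2) — displayed, never asserted of [I]'s (1.22).  Row D4 class UNCHANGED (critical-path width 0; instance 0∕1; D4 DISCHARGE
NO DATE).  HONEST DEPENDENCY: continuum YM on T⁴ ⇐ BetaPertH ∧ nine spine estimates (0/9 proved); BetaPertH ⇐ (D1) ∧ (D4) ∧ CAP+tail;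
G-an2-4 gates asym, D1 and NE2/3/4.

WHAT IS PROVED ([folklore]; 0 `def`, 0 sorry).  **`eq_gstar_of_memFlow_rows_closed`** (`M·γ ≤ 3√3·b` ⟹ any box solution of the
`betaInf β`-flow from `g_IR` IS `gstar g`), `existsUnique_memFlow_betaInf_rows_closed`, **`gstar_eq_gstar_of_betaInf_agree_rows_closed`**
(same pin, limit functionals agreeing on the box ⟹ same continuum running coupling — under `M·γ ≤ 3√3·b`), `gstar_eq_solution_rows_sharp`
(`M·γ < 3√3·b` ⟹ `gstar g` = the lattice-free Picard limit), **`abs_gstar_sub_gstar_le_of_betaInf_close_rows_sharp`** (`M·γ < 3√3·b` ⟹ two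
families with `η`-close limit functionals have continuum couplings within `(γ³∕2·|1∕g_IR² − 1∕g_IRt²| + (γ∕(3√3·b))·η)∕(1 − M·γ∕(3√3·b))`).
-/

noncomputable section
open Filter Topology Finset

namespace Summit.QuantumFields.BalabanUV.Beta.EriceRemainderEnclosureHistoryAutonomyEndSharp

open Literature.MathematicalPhysics.QuantumFieldTheory.Balaban1983to89
open Literature.MathematicalPhysics.QuantumFieldTheory.Balaban1983to89.FlowStep
open Literature.MathematicalPhysics.QuantumFieldTheory.Balaban1983to89.T4CouplingMatching
open Literature.MathematicalPhysics.QuantumFieldTheory.Balaban1983to89.T4CauchySum (InjectedRate)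
open Literature.MathematicalPhysics.QuantumFieldTheory.Balaban1983to89.T4ContinuumCoupling
open Literature.MathematicalPhysics.QuantumFieldTheory.Balaban1983to89.T4BetaStationary
open Literature.MathematicalPhysics.QuantumFieldTheory.Balaban1983to89.T4BetaFlowWellPosed (MemFlow solution)
open Summit.QuantumFields.BalabanUV.Beta.EriceRemainderEnclosureHistoryAutonomy
open Summit.QuantumFields.BalabanUV.Beta.EriceRemainderEnclosureHistoryAutonomyEnd
open Summit.QuantumFields.BalabanUV.Beta.EriceRemainderEnclosureHistoryAutonomyThreshold
open Summit.QuantumFields.BalabanUV.Beta.EriceRemainderEnclosureHistoryAutonomyThresholdWellPosed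

variable {β βt : HBeta} {γ c θs : ℝ} {Λ Λt : ℕ → ℕ → ℝ} {M : ℝ}
variable {g gt : ℕ → ℕ → ℝ} {gIR gIRt C θ₁ Ct θt ct θst b η : ℝ} {k₀ : ℕ}

/-- **THE CONTINUUM RUNNING COUPLING IS THE UNIQUE BOX SOLUTION — AT THE SHARP, CLOSED CONSTANT.**  (E37c)'s `eq_gstar_of_memFlow_rows`
with `M·γ < b` REPLACED by `M·γ ≤ 3√3·b`: ANY box solution of the `betaInf β`-flow from `g_IR` is `gstar g`. [folklore] -/
theorem eq_gstar_of_memFlow_rows_closed (hθ1 : θ₁ < 1) (hinj : InjectedRate C 0 θ₁ (fun K j => disc (g K) (g (K + 1)) j))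
    (hbox : ∀ K i, i ≤ K → 0 < g K i ∧ g K i ≤ γ) (hrun : ∀ K, RGEqH K β (g K)) (hpin : ∀ K, g K K = gIR)
    (hss : ScaleShiftRate c θs γ β) (hL : HistLipschitz Λ γ β) (hΛ : ∀ k i, i ≤ k → 0 ≤ Λ k i)
    (hrow : ∀ k, ∑ i ∈ range (k + 1), Λ k i ≤ M) (hθs0 : 0 ≤ θs) (hθs1 : θs < 1) (hev : EventualLowerH b γ k₀ β)
    (hb : 0 < b) (hsmall : M * γ ≤ 3 * Real.sqrt 3 * b) {h : ℕ → ℝ} (hh : SeqBox γ h) (hf : MemFlow (betaInf β) gIR h) :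
    h = gstar g := by
  have hgIR : 0 < gIR := by rw [← hpin 0]; exact (hbox 0 0 le_rfl).1
  have hgIRγ : gIR ≤ γ := by rw [← hpin 0]; exact (hbox 0 0 le_rfl).2
  have hconv : ∀ m, Tendsto (invSq g m) atTop (𝓝 (astar g m)) := fun m => tendsto_invSq hθ1 hinj m
  exact memFlow_unique_zs_closed (zerothMoment_betaInf_of_rows hss hθs1 hL hΛ hrow) (rowBound_nonneg hΛ hrow) hgIR hgIRγ hb
    (fun u hu => le_betaInf_of_eventualLower hss hθs1 hev hu) hsmall hh (seqBox_gstar_of_tendsto hbox hconv) hf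
    (memFlow_gstar_of_injectedRate hθ1 hinj hbox hrun hpin hss hL hθs0 hθs1)

/-- … WELL-POSEDNESS of the `betaInf β`-flow on the box under `M·γ ≤ 3√3·b`, its solution being `gstar g`. [folklore] -/
theorem existsUnique_memFlow_betaInf_rows_closed (hθ1 : θ₁ < 1)
    (hinj : InjectedRate C 0 θ₁ (fun K j => disc (g K) (g (K + 1)) j))
    (hbox : ∀ K i, i ≤ K → 0 < g K i ∧ g K i ≤ γ) (hrun : ∀ K, RGEqH K β (g K)) (hpin : ∀ K, g K K = gIR)
    (hss : ScaleShiftRate c θs γ β) (hL : HistLipschitz Λ γ β) (hΛ : ∀ k i, i ≤ k → 0 ≤ Λ k i)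
    (hrow : ∀ k, ∑ i ∈ range (k + 1), Λ k i ≤ M) (hθs0 : 0 ≤ θs) (hθs1 : θs < 1) (hev : EventualLowerH b γ k₀ β)
    (hb : 0 < b) (hsmall : M * γ ≤ 3 * Real.sqrt 3 * b) :
    (∃! h : ℕ → ℝ, SeqBox γ h ∧ MemFlow (betaInf β) gIR h) ∧ SeqBox γ (gstar g) ∧ MemFlow (betaInf β) gIR (gstar g) := by
  have hconv : ∀ m, Tendsto (invSq g m) atTop (𝓝 (astar g m)) := fun m => tendsto_invSq hθ1 hinj m
  have hsol := seqBox_gstar_of_tendsto hbox hconv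
  have hmem := memFlow_gstar_of_injectedRate hθ1 hinj hbox hrun hpin hss hL hθs0 hθs1
  exact ⟨⟨gstar g, ⟨hsol, hmem⟩, fun h hh =>
    eq_gstar_of_memFlow_rows_closed hθ1 hinj hbox hrun hpin hss hL hΛ hrow hθs0 hθs1 hev hb hsmall hh.1 hh.2⟩, hsol, hmem⟩

/-- **UNIVERSALITY AT THE SHARP, CLOSED CONSTANT**: two families with the same pin whose limit functionals agree on the box have the same
continuum running coupling — the first family carrying rows `≤ M` with `M·γ ≤ 3√3·b` and a floor, the second only node U2's shapes. [folklore] -/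
theorem gstar_eq_gstar_of_betaInf_agree_rows_closed (hθ1 : θ₁ < 1)
    (hinj : InjectedRate C 0 θ₁ (fun K j => disc (g K) (g (K + 1)) j))
    (hbox : ∀ K i, i ≤ K → 0 < g K i ∧ g K i ≤ γ) (hrun : ∀ K, RGEqH K β (g K)) (hpin : ∀ K, g K K = gIR)
    (hss : ScaleShiftRate c θs γ β) (hL : HistLipschitz Λ γ β) (hΛ : ∀ k i, i ≤ k → 0 ≤ Λ k i)
    (hrow : ∀ k, ∑ i ∈ range (k + 1), Λ k i ≤ M) (hθs0 : 0 ≤ θs) (hθs1 : θs < 1) (hev : EventualLowerH b γ k₀ β)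
    (hb : 0 < b) (hsmall : M * γ ≤ 3 * Real.sqrt 3 * b)
    (hθt1 : θt < 1) (hinjt : InjectedRate Ct 0 θt (fun K j => disc (gt K) (gt (K + 1)) j))
    (hboxt : ∀ K i, i ≤ K → 0 < gt K i ∧ gt K i ≤ γ) (hrunt : ∀ K, RGEqH K βt (gt K)) (hpint : ∀ K, gt K K = gIR)
    (hsst : ScaleShiftRate ct θst γ βt) (hLt : HistLipschitz Λt γ βt) (hθst0 : 0 ≤ θst) (hθst1 : θst < 1)
    (hagree : ∀ u, SeqBox γ u → betaInf β u = betaInf βt u) : gstar g = gstar gt := by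
  have hconvt : ∀ m, Tendsto (invSq gt m) atTop (𝓝 (astar gt m)) := fun m => tendsto_invSq hθt1 hinjt m
  have hmemt := memFlow_gstar_of_injectedRate hθt1 hinjt hboxt hrunt hpint hsst hLt hθst0 hθst1
  -- `gstar gt` solves the `betaInf βt`-flow, hence (the functionals agree on the box) the `betaInf β`-flow
  have hmemt' : MemFlow (betaInf β) gIR (gstar gt) := by
    refine ⟨hmemt.1, fun m => ?_⟩
    rw [hmemt.2 m, hagree _ (T4BetaFlowWellPosed.seqBox_shift (seqBox_gstar_of_tendsto hboxt hconvt) (m + 1))]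
  exact (eq_gstar_of_memFlow_rows_closed hθ1 hinj hbox hrun hpin hss hL hΛ hrow hθs0 hθs1 hev hb hsmall
    (seqBox_gstar_of_tendsto hboxt hconvt) hmemt').symm

/-- `gstar g` is the scale-wise limit of the lattice-free Picard iterates of `betaInf β` — under the sharp OPEN `M·γ < 3√3·b` ((E38b)'s
contraction). [folklore] -/
theorem gstar_eq_solution_rows_sharp (hθ1 : θ₁ < 1) (hinj : InjectedRate C 0 θ₁ (fun K j => disc (g K) (g (K + 1)) j))
    (hbox : ∀ K i, i ≤ K → 0 < g K i ∧ g K i ≤ γ) (hrun : ∀ K, RGEqH K β (g K)) (hpin : ∀ K, g K K = gIR)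
    (hss : ScaleShiftRate c θs γ β) (hL : HistLipschitz Λ γ β) (hΛ : ∀ k i, i ≤ k → 0 ≤ Λ k i)
    (hrow : ∀ k, ∑ i ∈ range (k + 1), Λ k i ≤ M) (hθs0 : 0 ≤ θs) (hθs1 : θs < 1) (hev : EventualLowerH b γ k₀ β)
    (hb : 0 < b) (hsmall : M * γ < 3 * Real.sqrt 3 * b) : gstar g = solution (betaInf β) gIR := by
  have hgIR : 0 < gIR := by rw [← hpin 0]; exact (hbox 0 0 le_rfl).1
  have hgIRγ : gIR ≤ γ := by rw [← hpin 0]; exact (hbox 0 0 le_rfl).2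
  have hconv : ∀ m, Tendsto (invSq g m) atTop (𝓝 (astar g m)) := fun m => tendsto_invSq hθ1 hinj m
  exact eq_solution_of_memFlow_zs (zerothMoment_betaInf_of_rows hss hθs1 hL hΛ hrow) (rowBound_nonneg hΛ hrow) hgIR hgIRγ
    hb (fun u hu => le_betaInf_of_eventualLower hss hθs1 hev hu) hsmall (seqBox_gstar_of_tendsto hbox hconv)
    (memFlow_gstar_of_injectedRate hθ1 hinj hbox hrun hpin hss hL hθs0 hθs1)

/-- **STABILITY ACROSS LATTICE FAMILIES AT THE SHARP CONSTANT**: two families — `g` for `β` (rows `≤ M`, floor `b`, `M·γ < 3√3·b`), `gt` for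
`βt` (node U2's shapes and a floor `b`) — whose limit functionals are `η`-close on the box have continuum running couplings within
`(γ³∕2·|1∕g_IR² − 1∕g_IRt²| + (γ∕(3√3·b))·η)∕(1 − M·γ∕(3√3·b))` at EVERY scale ((E38b) `memFlow_stability_zs`). [folklore] -/
theorem abs_gstar_sub_gstar_le_of_betaInf_close_rows_sharp (hθ1 : θ₁ < 1)
    (hinj : InjectedRate C 0 θ₁ (fun K j => disc (g K) (g (K + 1)) j))
    (hbox : ∀ K i, i ≤ K → 0 < g K i ∧ g K i ≤ γ) (hrun : ∀ K, RGEqH K β (g K)) (hpin : ∀ K, g K K = gIR)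
    (hss : ScaleShiftRate c θs γ β) (hL : HistLipschitz Λ γ β) (hΛ : ∀ k i, i ≤ k → 0 ≤ Λ k i)
    (hrow : ∀ k, ∑ i ∈ range (k + 1), Λ k i ≤ M) (hθs0 : 0 ≤ θs) (hθs1 : θs < 1) (hev : EventualLowerH b γ k₀ β)
    (hb : 0 < b) (hsmall : M * γ < 3 * Real.sqrt 3 * b)
    (hθt1 : θt < 1) (hinjt : InjectedRate Ct 0 θt (fun K j => disc (gt K) (gt (K + 1)) j))
    (hboxt : ∀ K i, i ≤ K → 0 < gt K i ∧ gt K i ≤ γ) (hrunt : ∀ K, RGEqH K βt (gt K)) (hpint : ∀ K, gt K K = gIRt)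
    (hsst : ScaleShiftRate ct θst γ βt) (hLt : HistLipschitz Λt γ βt) (hθst0 : 0 ≤ θst) (hθst1 : θst < 1)
    (hevt : EventualLowerH b γ k₀ βt)
    (hη : ∀ u, SeqBox γ u → |betaInf β u - betaInf βt u| ≤ η) (m : ℕ) :
    |gstar g m - gstar gt m| ≤ (γ ^ 3 / 2 * |1 / gIR ^ 2 - 1 / gIRt ^ 2| + γ / (3 * Real.sqrt 3 * b) * η)
      / (1 - M * γ / (3 * Real.sqrt 3 * b)) := by
  have hgIR : 0 < gIR := by rw [← hpin 0]; exact (hbox 0 0 le_rfl).1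
  have hgIRγ : gIR ≤ γ := by rw [← hpin 0]; exact (hbox 0 0 le_rfl).2
  have hgIRt : 0 < gIRt := by rw [← hpint 0]; exact (hboxt 0 0 le_rfl).1
  have hgIRtγ : gIRt ≤ γ := by rw [← hpint 0]; exact (hboxt 0 0 le_rfl).2
  have hconv : ∀ m, Tendsto (invSq g m) atTop (𝓝 (astar g m)) := fun m => tendsto_invSq hθ1 hinj m
  have hconvt : ∀ m, Tendsto (invSq gt m) atTop (𝓝 (astar gt m)) := fun m => tendsto_invSq hθt1 hinjt m
  exact memFlow_stability_zs (zerothMoment_betaInf_of_rows hss hθs1 hL hΛ hrow) (rowBound_nonneg hΛ hrow) hgIR hgIRγ hgIRt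
    hgIRtγ hb (fun u hu => le_betaInf_of_eventualLower hss hθs1 hev hu) (fun u hu => le_betaInf_of_eventualLower hsst hθst1 hevt hu)
    hsmall hη (seqBox_gstar_of_tendsto hbox hconv) (seqBox_gstar_of_tendsto hboxt hconvt)
    (memFlow_gstar_of_injectedRate hθ1 hinj hbox hrun hpin hss hL hθs0 hθs1)
    (memFlow_gstar_of_injectedRate hθt1 hinjt hboxt hrunt hpint hsst hLt hθst0 hθst1) m

end Summit.QuantumFields.BalabanUV.Beta.EriceRemainderEnclosureHistoryAutonomyEndSharp

end
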